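import Summits.Langlands.Langlands.Theses.RetentionCarving
import Literature.NumberTheory.Automorphic.IwahoriGL
import Literature.NumberTheory.Automorphic.EssConjSelfDual
import Literature.NumberTheory.GaloisRepresentations.FramedRepTwist

/-!
# Glue of the layer-2 SPLIT of `CuspidalAvatarIrreducible` (route RetentionCarving) — target
`Summits/Langlands/Langlands/Theorems/RetentionCarvingCuspidalAvatarIrreducibleOfSplit.lean`

Closes the glue item `CuspidalAvatarIrreducible_of_split : PolarizedShadowIrreducible → UnpolarizedSteinbergShadowIrreducible →
RegularMonodromyNoSteinbergShadowIrreducible → UnpolarizedRegularShadowIrreducible → ShadowlessGenericIrreducible → CuspidalAvatarIrreducible`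
generated by `ledger route edit route-Langlands-RetentionCarving --split CuspidalAvatarIrreducible --into children.json --planner-approved …
--glue-decl-name CuspidalAvatarIrreducible_of_split` (lens-2-g9 node `ShadowDepthTrichotomy`, decomp-langlands, 2026-08-30).  Landed after the split of record (route-Langlands-RetentionCarving rev 2, 2026-08-30T12:32Z), mock block removed.  Certified beforehand against the
lens's mock AND against a verbatim copy of the route file of record (rev 1) extended exactly as the gate renders the split (`kit_check_rc.lean`:
rc 0 · 0 sorry · axioms propext / Classical.choice / Quot.sound).  PURE LOGIC: strong induction on the rank `n` (every cell carries the
induction hypothesis «Irr at every rank m < n, all number fields» inlined, VERBATIM as stmt-Langlands-31315 does) and excluded middles on INLINED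
dials — PSH(ρ) («ρ has a polarized regular CM shadow»): PSH → POL-cell; else RM(π) («π has a regular-monodromy place»): RM ∧ SRS(ρ) («Steinberg
regular CM shadow») → LIM-cell, RM ∧ ¬SRS → RMD-cell; ¬RM ∧ RS(ρ) («some regular CM shadow») → UNP-cell, ¬RM ∧ ¬RS → NRD-cell; every cell is fed
with the induction hypothesis.  No W⁺, no sibling item, 0 EQUIV, no definitions, no new mathematics.
-/

set_option linter.dupNamespace false -- project-wide option; `Summit.Langlands.Langlands` is the mandated namespace


namespace Summit.Langlands.Langlands.Theorems

open scoped Classical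
open Filter
open Summit.Langlands.Langlands.Theses

/-- The glue item of the lens-2-g9 split of `RetentionCarving.CuspidalAvatarIrreducible` (Irr, stmt-Langlands-23601): the five children
POL `PolarizedShadowIrreducible`, LIM `UnpolarizedSteinbergShadowIrreducible`, RMD `RegularMonodromyNoSteinbergShadowIrreducible`,
UNP `UnpolarizedRegularShadowIrreducible` and NRD `ShadowlessGenericIrreducible` (the last two carrying the rank induction hypothesis) imply the
parent, by strong induction on the rank and cases on the inlined dials. -/
theorem RetentionCarving_CuspidalAvatarIrreducible_of_split_proof :
    Summit.Langlands.Langlands.Theses.RetentionCarving.CuspidalAvatarIrreducible_of_split := by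
  intro hPOL hLIM hRMD hUNP hNRD
  suffices h : ∀ (m : ℕ), ∀ (K : Type) [Field K] [NumberField K] (hcpt : Literature.NumberTheory.Automorphic.isCompact_glFiniteIntegralLevel m K), 0 < m → ∀ (π : Literature.NumberTheory.Automorphic.CuspidalAutomorphicRepData m K hcpt), π.1.IsLAlgebraic → ∀ (ℓ : ℕ) [Fact ℓ.Prime] (ι : PadicAlgCl ℓ ≃+* ℂ) (ρ : Literature.NumberTheory.GaloisRepresentations.FramedGaloisRep K (PadicAlgCl ℓ) m), ρ.toGaloisRep.IsSemisimple → (∀ᶠ v : IsDedekindDomain.HeightOneSpectrum (NumberField.RingOfIntegers K) in cofinite, SatakeFrobCompatibleAt ι π.1 ρ v) → ρ.toGaloisRep.IsIrreducible from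
    fun K _ _ n hcpt hn π hL ℓ _ ι ρ hss hρ => h n K hcpt hn π hL ℓ ι ρ hss hρ
  intro m
  induction m using Nat.strong_induction_on with
  | _ n ih =>
    intro K _ _ hcpt hn π hL ℓ _ ι ρ hss hρ
    by_cases hpsh : (∃ (L : Type) (_ : Field L) (_ : NumberField L) (_ : NumberField.IsCMField L) (hcptL : Literature.NumberTheory.Automorphic.isCompact_glFiniteIntegralLevel n L) (P : Literature.NumberTheory.Automorphic.CuspidalAutomorphicRepData n L hcptL), (∃ T : Literature.NumberTheory.Automorphic.InfinityType L n, P.1.HasInfinityType T ∧ T.IsLAlgebraic ∧ T.IsRegular) ∧ (∃ (χ : Literature.NumberTheory.GaloisRepresentations.HeckeCharacter L) (m : ℤ), (∀ x : Literature.NumberTheory.GaloisRepresentations.ideleGroup L, ((χ x : ℂˣ) : ℂ) = (Literature.NumberTheory.GaloisRepresentations.ideleNorm x : ℂ) ^ (m : ℂ)) ∧ P.1.IsEssConjSelfDual χ) ∧ ∃ ρP : Literature.NumberTheory.GaloisRepresentations.FramedGaloisRep L (PadicAlgCl ℓ) n, ρP.toGaloisRep.IsSemisimple ∧ (∀ᶠ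 u : IsDedekindDomain.HeightOneSpectrum (NumberField.RingOfIntegers L) in cofinite, SatakeFrobCompatibleAt ι P.1 ρP u) ∧ ∃ (M : Type) (_ : Field M) (_ : NumberField M) (_ : Algebra K M) (_ : Algebra L M) (η : ContinuousMonoidHom (Field.absoluteGaloisGroup M) (PadicAlgCl ℓ)ˣ), IsConjugate (ρ.restrictField M) ((ρP.restrictField M).twist η))
    · exact hPOL K n hcpt hn π hL (fun m hm => ih m hm) ℓ ι ρ hss hρ hpsh
    · by_cases hrm : (∃ (v : IsDedekindDomain.HeightOneSpectrum (NumberField.RingOfIntegers K)) (πv : Literature.NumberTheory.Automorphic.SmoothIrrep (Matrix.GeneralLinearGroup (Fin n) (v.adicCompletion K))), π.1.HasLocalComponentAt v πv.ρ ∧ (∀ [MeasurableSpace (Matrix.GeneralLinearGroup (Fin n) (v.adicCompletion K) ⧸ Subgroup.center (Matrix.GeneralLinearGroup (Fin n) (v.adicCompletion K)))] [BorelSpace (Matrix.GeneralLinearGroup (Fin n) (v.adicCompletion K) ⧸ Subgroup.center (Matrix.GeneralLinearGroup (Fin n) (v.adicCompletion K)))] (μ : MeasureTheory.Measure (Matrix.GeneralLinearGroup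 (Fin n) (v.adicCompletion K) ⧸ Subgroup.center (Matrix.GeneralLinearGroup (Fin n) (v.adicCompletion K)))) [μ.IsHaarMeasure], πv.ρ.IsEssentiallyDiscreteSeries μ) ∧ ∃ χ : Matrix.GeneralLinearGroup (Fin n) (v.adicCompletion K) →* ℂˣ, IsOpen (χ.ker : Set (Matrix.GeneralLinearGroup (Fin n) (v.adicCompletion K))) ∧ ∃ w : πv.V, w ≠ 0 ∧ ∀ g ∈ Literature.NumberTheory.Automorphic.iwahoriGL n (v.adicCompletion K), (πv.ρ.twist χ) g w = w)
      · by_cases hsrs : (∃ (L : Type) (_ : Field L) (_ : NumberField L) (_ : NumberField.IsCMField L) (hcptL : Literature.NumberTheory.Automorphic.isCompact_glFiniteIntegralLevel n L) (P : Literature.NumberTheory.Automorphic.CuspidalAutomorphicRepData n L hcptL), (∃ T : Literature.NumberTheory.Automorphic.InfinityType L n, P.1.HasInfinityType T ∧ T.IsLAlgebraic ∧ T.IsRegular) ∧ (∃ (v : IsDedekindDomain.HeightOneSpectrum (NumberField.RingOfIntegers L)) (πv : Literature.NumberTheory.Automorphic.SmoothIrrep (Matrix.GeneralLinearGroup (Fin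 n) (v.adicCompletion L))), P.1.HasLocalComponentAt v πv.ρ ∧ (∀ [MeasurableSpace (Matrix.GeneralLinearGroup (Fin n) (v.adicCompletion L) ⧸ Subgroup.center (Matrix.GeneralLinearGroup (Fin n) (v.adicCompletion L)))] [BorelSpace (Matrix.GeneralLinearGroup (Fin n) (v.adicCompletion L) ⧸ Subgroup.center (Matrix.GeneralLinearGroup (Fin n) (v.adicCompletion L)))] (μ : MeasureTheory.Measure (Matrix.GeneralLinearGroup (Fin n) (v.adicCompletion L) ⧸ Subgroup.center (Matrix.GeneralLinearGroup (Fin n) (v.adicCompletion L)))) [μ.IsHaarMeasure], πv.ρ.IsEssentiallyDiscreteSeries μ) ∧ ∃ χ : Matrix.GeneralLinearGroup (Fin n) (v.adicCompletion L) →* ℂˣ, IsOpen (χ.ker : Set (Matrix.GeneralLinearGroup (Fin n) (v.adicCompletion L))) ∧ ∃ w : πv.V, w ≠ 0 ∧ ∀ g ∈ Literature.NumberTheory.Automorphic.iwahoriGL n (v.adicCompletion L), (πv.ρ.twist χ) g w = w) ∧ ∃ ρP : Literature.NumberTheory.GaloisRepresentations.FramedGaloisRep L (PadicAlgCl ℓ)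 n, ρP.toGaloisRep.IsSemisimple ∧ (∀ᶠ u : IsDedekindDomain.HeightOneSpectrum (NumberField.RingOfIntegers L) in cofinite, SatakeFrobCompatibleAt ι P.1 ρP u) ∧ ∃ (M : Type) (_ : Field M) (_ : NumberField M) (_ : Algebra K M) (_ : Algebra L M) (η : ContinuousMonoidHom (Field.absoluteGaloisGroup M) (PadicAlgCl ℓ)ˣ), IsConjugate (ρ.restrictField M) ((ρP.restrictField M).twist η))
        · exact hLIM K n hcpt hn π hL hrm (fun m hm => ih m hm) ℓ ι ρ hss hρ hpsh hsrs
        · exact hRMD K n hcpt hn π hL hrm (fun m hm => ih m hm) ℓ ι ρ hss hρ hpsh hsrs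
      · by_cases hrs : (∃ (L : Type) (_ : Field L) (_ : NumberField L) (_ : NumberField.IsCMField L) (hcptL : Literature.NumberTheory.Automorphic.isCompact_glFiniteIntegralLevel n L) (P : Literature.NumberTheory.Automorphic.CuspidalAutomorphicRepData n L hcptL), (∃ T : Literature.NumberTheory.Automorphic.InfinityType L n, P.1.HasInfinityType T ∧ T.IsLAlgebraic ∧ T.IsRegular) ∧ ∃ ρP : Literature.NumberTheory.GaloisRepresentations.FramedGaloisRep L (PadicAlgCl ℓ) n, ρP.toGaloisRep.IsSemisimple ∧ (∀ᶠ u : IsDedekindDomain.HeightOneSpectrum (NumberField.RingOfIntegers L) in cofinite, SatakeFrobCompatibleAt ι P.1 ρP u) ∧ ∃ (M : Type) (_ : Field M) (_ : NumberField M) (_ : Algebra K M) (_ : Algebra L M) (η : ContinuousMonoidHom (Field.absoluteGaloisGroup M) (PadicAlgCl ℓ)ˣ), IsConjugate (ρ.restrictField M) ((ρP.restrictField M).twist η))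
        · exact hUNP K n hcpt hn π hL hrm (fun m hm => ih m hm) ℓ ι ρ hss hρ hpsh hrs
        · exact hNRD K n hcpt hn π hL hrm (fun m hm => ih m hm) ℓ ι ρ hss hρ hrs

end Summit.Langlands.Langlands.Theorems
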